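import Summits.CriticalPhenomena.PercolationContinuityZ3.Theorems.PercNearOneGluingNoHeavyLowerTailKnQuestion8CoefficientwiseCoreClassKernelMixHubPathGeneric
import HarnessLib

/-!
# The path lemma for the gate types `(j,j)` and `(u,j)`, all positions (PATH LEMMA of hub-Kleitman, memo §1.2)

Support file (`--supports stmt-CriticalPhenomena-4575`, closed), prover `prim-cplus-coupling` (gen 51).  No definitions, no notations,
no named facts, no sorries; standard axioms.  Memo `prim-cplus-coupling/A5-COUPLING-gen51.md` §1.2 (cases), §1.5, §2.6; memo-50 §2.8.

Word form as in `…KernelMixHubPathGeneric` (runs by their wall formulas; `𝒳, 𝒴` monotone predicates on vertex-index sets; `F` any family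
of words closed under hub moves).  This file removes the genericity hypotheses of `hubPath_generic` (memo §1.2):
* `hubPath_jj` — gate `(j,j)`: `W = {C_u ∪ C_b ∉ 𝒳, (C_u ∪ C_b)(complement) ∈ 𝒴}`.  Cases: `{w₀,w_ℓ} ∈ 𝒳` or `V ∉ 𝒴` give `W = ∅`;
  `{w₀,w_ℓ} ∈ 𝒴` ('U = all') is the instance `(𝒳', 𝒴') = (∅, 𝒳)` of the generic case read through complements; otherwise generic.
* `hubPath_uj` — gate `(u,j)`: `W = {C_u ∉ 𝒳, (C_u ∪ C_b)(complement) ∈ 𝒴}`.  Same cases; 'U = all' is now a threshold on the leading run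
  and is settled by ONE PREFIX FLIP `ω ↦ ω ∪ [1, s]`, `s = min {i : [0,i] ∈ 𝒳}` (memo §1.5, the `(u,u)` mechanism).
In both: `#(F ∩ W) ≤ #(F ∩ cW)`.  (Gate types `(j,u)`, `(u,u)` — explicit involutions of memo §1.5 — are separate files.)
[cite: KozmaNitzan2024, Questions 8–9 (§5.5 p. 36) (context)]
-/

namespace Summit.CriticalPhenomena.PercolationContinuityZ3.Theorems

open Finset
open scoped symmDiff

namespace Coefficientwise

open Classical in
/-- **PATH LEMMA, gate type `(j,j)`** (memo-50 §2.8), all positions of `𝒳, 𝒴`. [folklore] -/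
theorem hubPath_jj (ℓ : ℕ) (hℓ : 2 ≤ ℓ)
    (X Y : Finset ℕ → Prop) (hXmono : ∀ S T : Finset ℕ, S ⊆ T → X S → X T)
    (hYmono : ∀ S T : Finset ℕ, S ⊆ T → Y S → Y T)
    (D : Finset ℕ → Finset ℕ) (hD : ∀ ω, D ω = (Icc 1 (ℓ - 1)).filter (fun k => ¬ (k ∈ ω ↔ k + 1 ∈ ω)))
    (ri ra rj rb : Finset ℕ → ℕ)
    (hri : ∀ ω, ri ω = if 1 ∈ ω then (if h : (D ω).Nonempty then (D ω).min' h else ℓ) else 0)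
    (hra : ∀ ω, ra ω = if 1 ∈ ω then 0 else (if h : (D ω).Nonempty then (D ω).min' h else ℓ))
    (hrj : ∀ ω, rj ω = if ℓ ∈ ω then (if h : (D ω).Nonempty then ℓ - (D ω).max' h else ℓ) else 0)
    (hrb : ∀ ω, rb ω = if ℓ ∈ ω then 0 else (if h : (D ω).Nonempty then ℓ - (D ω).max' h else ℓ))
    (W cW : Finset ℕ → Prop)
    (hW : ∀ ω, W ω ↔ ¬ X (Icc 0 (ri ω) ∪ Icc (ℓ - rj ω) ℓ) ∧ Y (Icc 0 (ra ω) ∪ Icc (ℓ - rb ω) ℓ))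
    (hcW : ∀ ω, cW ω ↔ ¬ X (Icc 0 (ra ω) ∪ Icc (ℓ - rb ω) ℓ) ∧ Y (Icc 0 (ri ω) ∪ Icc (ℓ - rj ω) ℓ))
    (F : Finset (Finset ℕ)) (hFsub : ∀ ω ∈ F, ω ⊆ Icc 1 ℓ)
    (hFup : ∀ ω ∈ F, ∀ a b : ℕ, a ≤ b → b ≤ ℓ → (∀ k ∈ ω, a < k) → (∀ k ∈ ω, k ≤ b) →
      ω ∪ Icc 1 a ∪ Icc (b + 1) ℓ ∈ F) :
    (F.filter (fun ω => W ω)).card ≤ (F.filter (fun ω => cW ω)).card := by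
  classical
  have hDle := hubPath_walls_le ℓ D hD
  -- the values contain {w₀, w_ℓ} and lie in [0, ℓ]
  have hlow : ∀ x y, Icc 0 0 ∪ Icc ℓ ℓ ⊆ Icc 0 x ∪ Icc (ℓ - y) ℓ := fun x y =>
    Finset.union_subset_union (Finset.Icc_subset_Icc_right (Nat.zero_le _)) (Finset.Icc_subset_Icc_left (by omega))
  have hra_le : ∀ ω, ra ω ≤ ℓ := by
    intro ω; rw [hra]
    split_ifs with h1 h
    · exact Nat.zero_le _
    · have := hDle ω _ ((D ω).min'_mem h); omega
    · exact le_refl _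
  have hri_le : ∀ ω, ri ω ≤ ℓ := by
    intro ω; rw [hri]
    split_ifs with h1 h
    · have := hDle ω _ ((D ω).min'_mem h); omega
    · exact le_refl _
    · exact Nat.zero_le _
  have hup : ∀ x y, x ≤ ℓ → Icc 0 x ∪ Icc (ℓ - y) ℓ ⊆ Icc 0 ℓ := fun x y hx =>
    Finset.union_subset (Finset.Icc_subset_Icc_right hx) (Finset.Icc_subset_Icc_left (Nat.zero_le _))
  by_cases hX0 : X (Icc 0 0 ∪ Icc ℓ ℓ)
  · -- {w₀, w_ℓ} ∈ 𝒳 : W = ∅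
    have h0 : F.filter (fun ω => W ω) = ∅ := Finset.filter_eq_empty_iff.mpr fun ω _ hWω =>
      ((hW ω).mp hWω).1 (hXmono _ _ (hlow _ _) hX0)
    rw [h0, Finset.card_empty]; exact Nat.zero_le _
  by_cases hY1 : Y (Icc 0 ℓ)
  swap
  · -- V ∉ 𝒴 : W = ∅
    have h0 : F.filter (fun ω => W ω) = ∅ := Finset.filter_eq_empty_iff.mpr fun ω _ hWω =>
      hY1 (hYmono _ _ (hup _ _ (hra_le ω)) ((hW ω).mp hWω).2)
    rw [h0, Finset.card_empty]; exact Nat.zero_le _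
  by_cases hY0 : Y (Icc 0 0 ∪ Icc ℓ ℓ)
  · -- U = all : read the generic case for (∅, 𝒳) through complements
    have hYall : ∀ x y, Y (Icc 0 x ∪ Icc (ℓ - y) ℓ) := fun x y => hYmono _ _ (hlow x y) hY0
    by_cases hX1 : X (Icc 0 ℓ)
    swap
    · have hXno : ∀ x y, x ≤ ℓ → ¬ X (Icc 0 x ∪ Icc (ℓ - y) ℓ) := fun x y hx h => hX1 (hXmono _ _ (hup x y hx) h)
      have h1 : F.filter (fun ω => W ω) = F :=
        Finset.filter_true_of_mem fun ω _ => (hW ω).mpr ⟨hXno _ _ (hri_le ω), hYall _ _⟩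
      have h2 : F.filter (fun ω => cW ω) = F :=
        Finset.filter_true_of_mem fun ω _ => (hcW ω).mpr ⟨hXno _ _ (hra_le ω), hYall _ _⟩
      rw [h1, h2]
    · obtain ⟨W', hW'⟩ : ∃ W' : Finset ℕ → Prop, ∀ ω, W' ω ↔
          ¬ False ∧ X (Icc 0 (ra ω) ∪ Icc (ℓ - rb ω) ℓ) := ⟨_, fun _ => Iff.rfl⟩
      obtain ⟨cW', hcW'⟩ : ∃ cW' : Finset ℕ → Prop, ∀ ω, cW' ω ↔
          ¬ False ∧ X (Icc 0 (ri ω) ∪ Icc (ℓ - rj ω) ℓ) := ⟨_, fun _ => Iff.rfl⟩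
      have hgen := hubPath_generic ℓ hℓ (fun _ => False) X (fun _ _ _ h => h) hXmono
        (fun i j => Icc 0 i ∪ Icc (ℓ - j) ℓ)
        (fun i j i' j' hi hj => Finset.union_subset_union (Finset.Icc_subset_Icc_right hi)
          (Finset.Icc_subset_Icc_left (by omega)))
        (fun h => h) hX0 hX1 D hD ri ra rj rb hri hra hrj hrb W' cW' hW' hcW' F hFsub hFup
      have e1 : F.filter (fun ω => W' ω) = F.filter (fun ω => ¬ cW ω) := by
        refine Finset.filter_congr fun ω _ => ?_
        rw [hW', hcW]
        constructor
        · rintro ⟨_, h⟩ ⟨h', _⟩; exact h' h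
        · intro h; refine ⟨fun h => h, ?_⟩
          by_contra hc; exact h ⟨hc, hYall _ _⟩
      have e2 : F.filter (fun ω => cW' ω) = F.filter (fun ω => ¬ W ω) := by
        refine Finset.filter_congr fun ω _ => ?_
        rw [hcW', hW]
        constructor
        · rintro ⟨_, h⟩ ⟨h', _⟩; exact h' h
        · intro h; refine ⟨fun h => h, ?_⟩
          by_contra hc; exact h ⟨hc, hYall _ _⟩
      rw [e1, e2] at hgen
      have c1 := Finset.card_filter_add_card_filter_not (s := F) (fun ω => W ω)
      have c2 := Finset.card_filter_add_card_filter_not (s := F) (fun ω => cW ω)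
      omega
  · -- generic position
    exact hubPath_generic ℓ hℓ X Y hXmono hYmono (fun i j => Icc 0 i ∪ Icc (ℓ - j) ℓ)
      (fun i j i' j' hi hj => Finset.union_subset_union (Finset.Icc_subset_Icc_right hi)
        (Finset.Icc_subset_Icc_left (by omega)))
      hX0 hY0 hY1 D hD ri ra rj rb hri hra hrj hrb W cW hW hcW F hFsub hFup

open Classical in
/-- **PATH LEMMA, gate type `(u,j)`** (memo-50 §2.8), all positions of `𝒳, 𝒴`. [folklore] -/
theorem hubPath_uj (ℓ : ℕ) (hℓ : 2 ≤ ℓ)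
    (X Y : Finset ℕ → Prop) (hXmono : ∀ S T : Finset ℕ, S ⊆ T → X S → X T)
    (hYmono : ∀ S T : Finset ℕ, S ⊆ T → Y S → Y T)
    (D : Finset ℕ → Finset ℕ) (hD : ∀ ω, D ω = (Icc 1 (ℓ - 1)).filter (fun k => ¬ (k ∈ ω ↔ k + 1 ∈ ω)))
    (ri ra rj rb : Finset ℕ → ℕ)
    (hri : ∀ ω, ri ω = if 1 ∈ ω then (if h : (D ω).Nonempty then (D ω).min' h else ℓ) else 0)
    (hra : ∀ ω, ra ω = if 1 ∈ ω then 0 else (if h : (D ω).Nonempty then (D ω).min' h else ℓ))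
    (hrj : ∀ ω, rj ω = if ℓ ∈ ω then (if h : (D ω).Nonempty then ℓ - (D ω).max' h else ℓ) else 0)
    (hrb : ∀ ω, rb ω = if ℓ ∈ ω then 0 else (if h : (D ω).Nonempty then ℓ - (D ω).max' h else ℓ))
    (W cW : Finset ℕ → Prop)
    (hW : ∀ ω, W ω ↔ ¬ X (Icc 0 (ri ω)) ∧ Y (Icc 0 (ra ω) ∪ Icc (ℓ - rb ω) ℓ))
    (hcW : ∀ ω, cW ω ↔ ¬ X (Icc 0 (ra ω)) ∧ Y (Icc 0 (ri ω) ∪ Icc (ℓ - rj ω) ℓ))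
    (F : Finset (Finset ℕ)) (hFsub : ∀ ω ∈ F, ω ⊆ Icc 1 ℓ)
    (hFup : ∀ ω ∈ F, ∀ a b : ℕ, a ≤ b → b ≤ ℓ → (∀ k ∈ ω, a < k) → (∀ k ∈ ω, k ≤ b) →
      ω ∪ Icc 1 a ∪ Icc (b + 1) ℓ ∈ F) :
    (F.filter (fun ω => W ω)).card ≤ (F.filter (fun ω => cW ω)).card := by
  classical
  have hℓ1 : 1 ≤ ℓ := by omega
  have hDle := hubPath_walls_le ℓ D hD
  have hlow : ∀ x y, Icc 0 0 ∪ Icc ℓ ℓ ⊆ Icc 0 x ∪ Icc (ℓ - y) ℓ := fun x y =>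
    Finset.union_subset_union (Finset.Icc_subset_Icc_right (Nat.zero_le _)) (Finset.Icc_subset_Icc_left (by omega))
  have hra_le : ∀ ω, ra ω ≤ ℓ := by
    intro ω; rw [hra]
    split_ifs with h1 h
    · exact Nat.zero_le _
    · have := hDle ω _ ((D ω).min'_mem h); omega
    · exact le_refl _
  have hri_le : ∀ ω, ri ω ≤ ℓ := by
    intro ω; rw [hri]
    split_ifs with h1 h
    · have := hDle ω _ ((D ω).min'_mem h); omega
    · exact le_refl _
    · exact Nat.zero_le _
  have hup : ∀ x y, x ≤ ℓ → Icc 0 x ∪ Icc (ℓ - y) ℓ ⊆ Icc 0 ℓ := fun x y hx =>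
    Finset.union_subset (Finset.Icc_subset_Icc_right hx) (Finset.Icc_subset_Icc_left (Nat.zero_le _))
  by_cases hX0 : X (Icc 0 0)
  · have h0 : F.filter (fun ω => W ω) = ∅ := Finset.filter_eq_empty_iff.mpr fun ω _ hWω =>
      ((hW ω).mp hWω).1 (hXmono _ _ (Finset.Icc_subset_Icc_right (Nat.zero_le _)) hX0)
    rw [h0, Finset.card_empty]; exact Nat.zero_le _
  by_cases hY1 : Y (Icc 0 ℓ)
  swap
  · have h0 : F.filter (fun ω => W ω) = ∅ := Finset.filter_eq_empty_iff.mpr fun ω _ hWω =>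
      hY1 (hYmono _ _ (hup _ _ (hra_le ω)) ((hW ω).mp hWω).2)
    rw [h0, Finset.card_empty]; exact Nat.zero_le _
  by_cases hY0 : Y (Icc 0 0 ∪ Icc ℓ ℓ)
  · -- U = all : a threshold on the leading run; one prefix flip
    have hYall : ∀ x y, Y (Icc 0 x ∪ Icc (ℓ - y) ℓ) := fun x y => hYmono _ _ (hlow x y) hY0
    by_cases hex : ∃ i, X (Icc 0 i)
    swap
    · push Not at hex
      have h1 : F.filter (fun ω => W ω) = F :=
        Finset.filter_true_of_mem fun ω _ => (hW ω).mpr ⟨hex _, hYall _ _⟩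
      have h2 : F.filter (fun ω => cW ω) = F :=
        Finset.filter_true_of_mem fun ω _ => (hcW ω).mpr ⟨hex _, hYall _ _⟩
      rw [h1, h2]
    · -- the threshold s
      obtain ⟨s, hs, hsmin⟩ : ∃ s, X (Icc 0 s) ∧ ∀ i, i < s → ¬ X (Icc 0 i) :=
        ⟨Nat.find hex, Nat.find_spec hex, fun i hi => Nat.find_min hex hi⟩
      have hs1 : 1 ≤ s := by
        by_contra h; have : s = 0 := by omega
        rw [this] at hs; exact hX0 hs
      have hXiff : ∀ i, X (Icc 0 i) ↔ s ≤ i := by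
        intro i; constructor
        · intro h; by_contra hc; exact hsmin i (by omega) h
        · intro h; exact hXmono _ _ (Finset.Icc_subset_Icc_right h) hs
      -- sources start blue with leading blue run ≥ s
      have hsrc : ∀ ω, ω ⊆ Icc 1 ℓ → W ω → ¬ cW ω → 1 ∉ ω ∧ s ≤ ra ω ∧ ∀ k ∈ ω, s < k := by
        intro ω hω hWω hncW
        have hXa : X (Icc 0 (ra ω)) := by
          by_contra h; exact hncW ((hcW ω).mpr ⟨h, hYall _ _⟩)
        have hsa : s ≤ ra ω := (hXiff _).mp hXa
        have h1 : 1 ∉ ω := by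
          intro h1; rw [hra, if_pos h1] at hsa; omega
        refine ⟨h1, hsa, fun k hk => ?_⟩
        rw [hra, if_neg h1] at hsa
        by_cases hDn : (D ω).Nonempty
        · rw [dif_pos hDn] at hsa
          have := hubPath_lt_of_mem_of_first_blue ℓ D hD ω hω h1 hDn k hk
          omega
        · rw [Finset.not_nonempty_iff_eq_empty] at hDn
          have := hubPath_eq_empty_of_first_blue ℓ D hD ω hω h1 hDn
          rw [this] at hk; simp at hk
      have hsℓ : ∀ ω, ω ⊆ Icc 1 ℓ → W ω → ¬ cW ω → s ≤ ℓ := fun ω hω hWω hncW =>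
        le_trans (hsrc ω hω hWω hncW).2.1 (hra_le ω)
      -- the flipped word starts with a red run of length ≥ s
      have hflip : ∀ ω, ω ⊆ Icc 1 ℓ → W ω → ¬ cW ω → s ≤ ri (ω ∪ Icc 1 s ∪ Icc (ℓ + 1) ℓ) := by
        intro ω hω hWω hncW
        obtain ⟨h1, hsa, hlead⟩ := hsrc ω hω hWω hncW
        have hsl := hsℓ ω hω hWω hncW
        rw [Finset.Icc_eq_empty_of_lt (Nat.lt_succ_self ℓ), Finset.union_empty, hri,
          if_pos (Finset.mem_union_right _ (Finset.mem_Icc.mpr ⟨le_refl _, hs1⟩))]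
        split_ifs with hDn
        · -- D(ω ∪ [1,s]) nonempty: its minimum is ≥ s
          by_cases hsn : s ≤ ℓ - 1
          · have hw := walls_prefix_fill ℓ D hD ω s hs1 hsn hlead
            have hmem : (D (ω ∪ Icc 1 s)).min' hDn ∈ D ω ∆ {s} := by
              rw [← hw]; exact (D (ω ∪ Icc 1 s)).min'_mem hDn
            rw [Finset.mem_symmDiff, Finset.mem_singleton] at hmem
            rcases hmem with ⟨hm, _⟩ | ⟨hm, _⟩
            · -- a wall of ω: ≥ min' D ω = ra ω ≥ s
              have hDn' : (D ω).Nonempty := ⟨_, hm⟩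
              rw [hra, if_neg h1, dif_pos hDn'] at hsa
              have := (D ω).min'_le _ hm
              omega
            · omega
          · -- s = ℓ: then ω = ∅ and the flipped word is constant
            have hsl' : s = ℓ := by omega
            have hω0 : ω = ∅ := by
              rw [Finset.eq_empty_iff_forall_notMem]
              intro k hk
              have := hlead k hk
              have := (Finset.mem_Icc.mp (hω hk)).2
              omega
            exfalso
            rw [hω0, Finset.empty_union, hsl', (hubPath_walls_const ℓ D hD).2] at hDn
            exact Finset.not_nonempty_empty hDn
        · exact hsl
      have hWf : F.filter (fun ω => W ω) = F.filter (fun ω => ω ⊆ Icc 1 ℓ ∧ W ω) := by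
        ext ω; simp only [Finset.mem_filter]
        exact ⟨fun ⟨hF, hw⟩ => ⟨hF, hFsub ω hF, hw⟩, fun ⟨hF, _, hw⟩ => ⟨hF, hw⟩⟩
      have hcWf : F.filter (fun ω => cW ω) = F.filter (fun ω => ω ⊆ Icc 1 ℓ ∧ cW ω) := by
        ext ω; simp only [Finset.mem_filter]
        exact ⟨fun ⟨hF, hw⟩ => ⟨hF, hFsub ω hF, hw⟩, fun ⟨hF, _, hw⟩ => ⟨hF, hw⟩⟩
      rw [hWf, hcWf]
      refine hub_card_filter_le_of_moveInjection F (fun ω => ω ⊆ Icc 1 ℓ ∧ W ω) (fun ω => ω ⊆ Icc 1 ℓ ∧ cW ω)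
        (fun ω ω' => ω' = ω ∪ Icc 1 s ∪ Icc (ℓ + 1) ℓ ∧ s ≤ ℓ ∧ ∀ k ∈ ω, s < k) ?_
        (fun ω => ω ∪ Icc 1 s ∪ Icc (ℓ + 1) ℓ) ?_ ?_
      · rintro ω hω ω' ⟨rfl, hsl, hlead⟩
        exact hFup ω hω s ℓ hsl (le_refl _) hlead fun k hk => (Finset.mem_Icc.mp (hFsub ω hω hk)).2
      · rintro ω ⟨hω, hWω⟩ hnc
        have hncW : ¬ cW ω := fun h => hnc ⟨hω, h⟩
        obtain ⟨_, _, hlead⟩ := hsrc ω hω hWω hncW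
        have hsl := hsℓ ω hω hWω hncW
        have hsub : ω ∪ Icc 1 s ∪ Icc (ℓ + 1) ℓ ⊆ Icc 1 ℓ := by
          refine Finset.union_subset (Finset.union_subset hω (Finset.Icc_subset_Icc_right hsl)) ?_
          rw [Finset.Icc_eq_empty_of_lt (Nat.lt_succ_self ℓ)]; exact Finset.empty_subset _
        have h1' : 1 ∈ ω ∪ Icc 1 s ∪ Icc (ℓ + 1) ℓ :=
          Finset.mem_union_left _ (Finset.mem_union_right _ (Finset.mem_Icc.mpr ⟨le_refl _, hs1⟩))
        refine ⟨⟨hsub, (hcW _).mpr ⟨?_, hYall _ _⟩⟩, fun h => ((hW _).mp h.2).1 ?_, rfl, hsl, hlead⟩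
        · rw [hra, if_pos h1']; exact hX0
        · exact (hXiff _).mpr (hflip ω hω hWω hncW)
      · rintro ω ω' ⟨hω, hWω⟩ hnc ⟨hω', hWω'⟩ hnc' h
        have hlead := (hsrc ω hω hWω (fun h' => hnc ⟨hω, h'⟩)).2.2
        have hlead' := (hsrc ω' hω' hWω' (fun h' => hnc' ⟨hω', h'⟩)).2.2
        have key : ∀ η : Finset ℕ, (∀ k ∈ η, s < k) → (η ∪ Icc 1 s ∪ Icc (ℓ + 1) ℓ) \ Icc 1 s = η := by
          intro η hη; ext k
          simp only [Finset.mem_sdiff, Finset.mem_union, Finset.mem_Icc]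
          constructor
          · rintro ⟨(hk | hk) | hk, hn⟩
            · exact hk
            · exact absurd hk hn
            · omega
          · intro hk; exact ⟨Or.inl (Or.inl hk), fun h' => by have := hη k hk; omega⟩
        rw [← key ω hlead, ← key ω' hlead', h]
  · exact hubPath_generic ℓ hℓ X Y hXmono hYmono (fun i _ => Icc 0 i)
      (fun i j i' j' hi _ => Finset.Icc_subset_Icc_right hi)
      hX0 hY0 hY1 D hD ri ra rj rb hri hra hrj hrb W cW hW hcW F hFsub hFup

end Coefficientwise

end Summit.CriticalPhenomena.PercolationContinuityZ3.Theorems
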